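import Literature.Barriers.NavierStokesRegularity.HypodissipativeLerayNonuniquenessProofs
import Literature.Analysis.FluidPDE.FracNSGalerkinAssembly
import HarnessLib

/-!
# Colombo–De Lellis–De Rosa 2018, Thm. 1.1 — discharged; Thm. 1.2 from Thm. 1.3 alone

Sibling proof file of the barrier entry
`Literature/Barriers/NavierStokesRegularity/HypodissipativeLerayNonuniqueness` (D-0021) and of its
proof-architecture file `HypodissipativeLerayNonuniquenessProofs`, which vendors the printed
ingredients of Colombo–De Lellis–De Rosa 2018, Thm. 1.2 as the named facts
`ColomboDeLellisDeRosa2018_thm11` (Thm. 1.1 with the remark after it: Leray solutions of the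
fractional Navier–Stokes system exist from every divergence-free `L²` datum, `α ∈ ]0,1[`),
`ColomboDeLellisDeRosa2018_thm13` (Thm. 1.3, the convex-integration theorem) and
`ColomboDeLellisDeRosa2018_prolongation` (the continuation remark, discharged there), and proves
the assembly `ColomboDeLellisDeRosa2018_thm12_of_thm11_of_thm13`.

This file **discharges Thm. 1.1**: `ColomboDeLellisDeRosa2018_thm11_holds`. The named fact is,
verbatim, the statement proved in the tree's Fourier–Galerkin development of the printed proof
(§9 = App. A of the paper, p. 20 of the held arXiv text) in `Literature/Analysis/FluidPDE/`:

* `FracNSGalerkin` — the scheme predicate `IsFracGalerkinScheme` and the decomposition of the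
  proof into `fracGalerkin_scheme_exists` (the regularised problems (NS_reg) "reduce to a system
  of ordinary differential equations for the Fourier coefficients", globally solvable by the
  energy identity `d/dt ∫|w|² = -2∫|(-Δ)^{α/2}w|²`) and `fracGalerkin_limit` (uniform bound
  `½∫|w_K|²(t) + ∫₀ᵗ∫|(-Δ)^{α/2}w_K|² ≤ ½∫|v̄|²`, extraction, strong `L²_loc` convergence by "a
  classical Aubin–Lions type argument", "which would show that `v` is a Leray solution");
* `FracNSGalerkinExistence`, `FracNSGalerkinAssembly` — the Galerkin ODE, its tested equations
  and energy identity, the scheme (`fracGalerkin_scheme_exists_holds`);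
* `FracNSGalerkinCompactness`, `FracNSGalerkinLimitField`, `FracNSGalerkinEnergy`,
  `FracNSGalerkinWeakForm`, `FracNSGalerkinLimit` — bounds, equicontinuity of the Fourier
  coefficients, diagonal extraction; the limit field, Fatou for the fractional dissipation,
  Friedrichs' inequality (the Fourier-side form of the Aubin–Lions step); the energy
  inequalities (2)–(3); the weak formulation with datum; `fracGalerkin_limit_holds`;
* `FracNSGalerkinAssembly` — `Literature.Analysis.FluidPDE.ColomboDeLellisDeRosa2018_thm11_holds`
  and the general form `Literature.Analysis.FluidPDE.Torus.exists_isLerayFracSolution` (every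
  dimension, every `α > 0`).

Consequence recorded here: `ColomboDeLellisDeRosa2018_thm12_of_thm13` — with Thm. 1.1 and the
continuation remark both proved, the named fact `ColomboDeLellisDeRosa2018_thm12` (Thm. 1.2,
non-uniqueness of Leray solutions for `α < 1/5`) rests on the convex-integration theorem
Thm. 1.3 alone ("Theorem 1.2 is thus an obvious corollary", §1 p. 3).

Theorem-only module (no definitions).

## References

* M. Colombo, C. De Lellis, L. De Rosa, *Ill-posedness of Leray solutions for the hypodissipative
  Navier–Stokes equations*, Comm. Math. Phys. 362 (2018), 659–688; arXiv:1708.05666, §1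
  (Thm. 1.1 with (2)–(3) and the remark on (3), Thms. 1.2–1.3, p. 3), §9 (proof of Thm. 1.1,
  p. 20). [`ColomboDelellisDerosa2018`]
-/

noncomputable section

open MeasureTheory Set Filter Topology Function
open scoped ENNReal NNReal InnerProductSpace

namespace Literature.Barriers.NavierStokesRegularity

/-! ## Thm. 1.1, proved: Leray solutions of the fractional system exist -/

/-- **Colombo–De Lellis–De Rosa 2018, Thm. 1.1 with the remark following it — discharged**
(§1 p. 3: "For any `v̄ ∈ L²(𝕋³)` with `div v̄ = 0` and every `α ∈ ]0,1[` there is a weak solution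
`u ∈ L^∞(ℝ⁺, L²(𝕋³)) ∩ L²(ℝ⁺, H^α(𝕋³))` of (NS) such that `v(·,0) = v̄` and (2) …"; "the
solution produced by the proof of Theorem 1.1 can be shown to satisfy … (3) … for a.e. `s` and
`∀ t > s`"; proof in §9 = App. A, p. 20: Fourier truncation `P_K`, the regularised problems
(NS_reg) as globally solvable ODEs with the energy identity `d/dt ∫|w|² = -2∫|(-Δ)^{α/2}w|²`,
the uniform bound `½∫|w_K|²(t) + ∫₀ᵗ∫|(-Δ)^{α/2}w_K|² ≤ ½∫|v̄|²`, extraction of a subsequence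
and strong `L²_loc` convergence by "a classical Aubin–Lions type argument", "which would show
that `v` is a Leray solution"). The named fact `ColomboDeLellisDeRosa2018_thm11` of
`HypodissipativeLerayNonuniquenessProofs` holds: it is, verbatim, the tree's theorem
`Literature.Analysis.FluidPDE.ColomboDeLellisDeRosa2018_thm11_holds`
(`Literature/Analysis/FluidPDE/FracNSGalerkinAssembly`), the end point of the Fourier–Galerkin
formalisation of the printed proof (see the module docstring), valid in every dimension and for
every `α > 0` (`Literature.Analysis.FluidPDE.Torus.exists_isLerayFracSolution`).
[cite: ColomboDelellisDerosa2018, §1 Thm. 1.1 and p. 3 (remark on (3)); proof §9 p. 20] -/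
theorem ColomboDeLellisDeRosa2018_thm11_holds : ColomboDeLellisDeRosa2018_thm11 :=
  fun α hα hα1 u₀ hu₀ hdiv =>
    Literature.Analysis.FluidPDE.ColomboDeLellisDeRosa2018_thm11_holds α hα hα1 u₀ hu₀ hdiv

/-! ## Thm. 1.2 from Thm. 1.3 alone -/

/-- **Thm. 1.2 from Thm. 1.3 alone** (Colombo–De Lellis–De Rosa 2018, §1 p. 3: "Each solution in
Theorem 1.3 can be prolonged past the time `T` using Theorem 1.1 … Theorem 1.2 is thus an
obvious corollary"): with Thm. 1.1 (`ColomboDeLellisDeRosa2018_thm11_holds`) and the continuation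
remark (`ColomboDeLellisDeRosa2018_prolongation_holds`) both discharged, the named fact
`ColomboDeLellisDeRosa2018_thm12` follows from the convex-integration theorem Thm. 1.3
(`ColomboDeLellisDeRosa2018_thm13`) alone, by `ColomboDeLellisDeRosa2018_thm12_of_thm11_of_thm13`.
[cite: ColomboDelellisDerosa2018, §1 p. 3 (Thm. 1.2 as a corollary of Thms. 1.1, 1.3)] -/
theorem ColomboDeLellisDeRosa2018_thm12_of_thm13 (h13 : ColomboDeLellisDeRosa2018_thm13) :
    ColomboDeLellisDeRosa2018_thm12 :=
  ColomboDeLellisDeRosa2018_thm12_of_thm11_of_thm13 ColomboDeLellisDeRosa2018_thm11_holds h13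

end Literature.Barriers.NavierStokesRegularity
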